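import Summits.AtomisticToContinuum.Crystallization.Theorems.LoopTunnelDialShellTail
import Summits.AtomisticToContinuum.Crystallization.Theorems.LoopTunnelDialDepthSep
import Summits.AtomisticToContinuum.Crystallization.Theorems.LoopTunnelDialSieveCurrency

/-!
# LoopTunnelDial — the FINITE-RANGE contact law, its bridge to stub 3, and THIN¾ (kit 7c) (lens-5 g19 range dial; crux `PocketCase`, stmt-AtomisticToContinuum-27294)

Kit file 7c (imports 7a/7b, the landed `DepthSep`, `ContactLaw` (via 7a) and `SieveCurrency`).  `FinContactHot ρ β R φ`: for every finite
`7/10`-separated point set in ONE closed `R`-ball about `x` with a partner `q` at distance `< ρ` and NET FORCE AT `x` OF NORM `≤ φ` (relaxed balance), the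
`R`-truncated site energy of `x` is `≥ β`.  BRIDGES (PROVED): `contactHot_of_finContactHot : FinContactHot ρ (b + tailE R) R (tailF R) → ContactHot ρ b`
(`1 ≤ R`, `ρ ≤ R`), `contactHotAbove_of_fin`, and for any certified tails `contactHot_of_finContactHot_of_farTails`.  REACH: `R = 8` dyadic
(`FinContactHot (3/4) (−3/10) 8 (tailF 8) ⟹ ContactHotAbove (3/4)` given `e⋆ ≤ −0.711`) and `R = 5` calibrated (`FinContactHot (3/4) (−1/2) 5 ((5⁻¹+5⁻⁷)τ₅) ⟹
ContactHotAbove (3/4)`).  THIN¾: `ThinSepCertified s` = `ThinCertified s` restricted to `3/4`-separated ground states — WEAKER, and EQUIVALENT modulo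
`ContactHotAbove (3/4)` (`thinCertified_iff_sep_of_hot`: a ground state with a pair below `3/4` has a hot particle; deleting it is the improving surgery) or
modulo `MinSepGS (3/4)`.

Every `def` below is line vocabulary of the LoopTunnelDial contact dial (crux stmt-AtomisticToContinuum-27294), not a cited fact.  0 sorry.
-/

noncomputable section

namespace Summit.AtomisticToContinuum.Crystallization.Theorems.LoopTunnelDialFinContact

open scoped BigOperators Classical InnerProductSpace
open Literature.MathematicalPhysics.StatisticalMechanics
open Literature.MathematicalPhysics.StatisticalMechanics.Yuhjtman2015 (hLJ)
open Summit.AtomisticToContinuum.Crystallization.Theorems.GrainPercolationDialCrossCeiling (E3 ballChunk)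
open Summit.AtomisticToContinuum.Crystallization.Theorems.ChargedEnergyGapNegative (eStar)
open Summit.AtomisticToContinuum.Crystallization.Theorems.OverbindingBudgetCubeTails (sum_inv_pow_six_le_dyadic)
open Summit.AtomisticToContinuum.Crystallization.Theorems.LjLaminarWindowsSketch (lennardJones_groundState_dist_ge_seven_tenths)
open Summit.AtomisticToContinuum.Crystallization.Theorems.LoopTunnelDialLocalSurgery (improvable_mono)
open Summit.AtomisticToContinuum.Crystallization.Theorems.LoopTunnelDialSieveCurrency
open Summit.AtomisticToContinuum.Crystallization.Theorems.LoopTunnelDialContactLaw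
open Summit.AtomisticToContinuum.Crystallization.Theorems.LoopTunnelDialDepthSep
open Summit.AtomisticToContinuum.Crystallization.Theorems.LoopTunnelDialRangeTails
open Summit.AtomisticToContinuum.Crystallization.Theorems.LoopTunnelDialShellTail

variable {N : ℕ}

/-! ### The finite-range contact law and the bridge (PROVED) -/

/-- **`FinContactHot ρ β R φ` — THE FINITE-RANGE CONTACT LAW.**  For every finite point set `s ⊂ ℝ³` lying in the closed `R`-ball about one
of its points `x`, pairwise `≥ 7/10` apart, with a point `q ≠ x` of `s` closer to `x` than `ρ`, and with the net Lennard-Jones force of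
`s ∖ {x}` on `x` of norm at most `φ` (`|∑ V′(r)⟪x − z, e⟫/r| ≤ φ‖e‖` for every `e`): the energy of `x` in `s` is at least `β`.
FINITE: `|s| ≤ (20R/7 + 1)³` (`card_le_of_finRange`); for rational dials a Tarski sentence — decidable, and the target of certified
branch-and-bound.  [TRANSFER · DECIDABLE · INSTRUMENTABLE · GS-free · `μ`-free · `e⋆`-free · `N`-free] -/
def FinContactHot (ρ β R φ : ℝ) : Prop :=
  ∀ (s : Finset E3) (x q : E3), x ∈ s → q ∈ s → q ≠ x → (∀ z ∈ s, dist x z ≤ R) →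
    (∀ z ∈ s, ∀ w ∈ s, z ≠ w → (7 : ℝ) / 10 ≤ dist z w) → dist x q < ρ →
    (∀ e : E3, |∑ z ∈ s.erase x, forceTerm x z e| ≤ φ * ‖e‖) →
    β ≤ ∑ z ∈ s.erase x, lennardJones (dist x z)

/-- The finite-range law is monotone in its four dials: smaller `ρ`, lower `β`, SMALLER force residual `φ` are weaker (the range `R` is not
monotone: a larger ball is a different finite problem). -/
theorem finContactHot_mono {ρ ρ' β β' R φ φ' : ℝ} (hρ : ρ' ≤ ρ) (hβ : β' ≤ β) (hφ : φ' ≤ φ) (h : FinContactHot ρ β R φ) :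
    FinContactHot ρ' β' R φ' :=
  fun s x q hx hq hqx hR hsep hd hF =>
    hβ.trans (h s x q hx hq hqx hR hsep (lt_of_lt_of_le hd hρ)
      (fun e => (hF e).trans (mul_le_mul_of_nonneg_right hφ (norm_nonneg _))))

/-- RUNG 0 of the finite law (vacuous below the separation constant). -/
theorem finContactHot_of_le_seven_tenths {ρ : ℝ} (hρ : ρ ≤ 7 / 10) (β R φ : ℝ) : FinContactHot ρ β R φ :=
  fun _ x q hx hq hqx _ hsep hd _ => absurd (lt_of_lt_of_le hd hρ) (not_lt.2 (by
    have := hsep q hq x hx hqx; rwa [dist_comm] at this))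

/-- **THE BRIDGE (PROVED): the finite-range law at range `R ≥ max(1, ρ)`, with the floor raised by the energy tail and force balance
relaxed to the force tail, implies the contact law.**  Truncate the configuration to the closed `R`-ball about the hot particle: exact
force balance leaves a residual of norm `≤ tailF R` on the truncation (`abs_sum_far_forceTerm_le`), and the far matter changes the site
energy by at most `tailE R` (`sum_far_abs_lennardJones_le`). -/
theorem contactHot_of_finContactHot {ρ b R : ℝ} (hR : 1 ≤ R) (hρR : ρ ≤ R)
    (h : FinContactHot ρ (b + tailE R) R (tailF R)) : ContactHot ρ b := by
  intro N y hy hsep k l hkl hlt hF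
  set I : Finset (Fin N) := nearIdx R y k with hI
  set s : Finset E3 := insert (y k) (I.image y) with hs
  have hk_notin : y k ∉ I.image y := by
    intro hmem
    obtain ⟨m, hm, hmk⟩ := Finset.mem_image.1 hmem
    exact Finset.ne_of_mem_erase (Finset.mem_filter.1 hm).1 (hy hmk)
  have hserase : s.erase (y k) = I.image y := by rw [hs, Finset.erase_insert hk_notin]
  have hsum_image : ∀ g : E3 → ℝ, ∑ z ∈ I.image y, g z = ∑ m ∈ I, g (y m) :=
    fun g => Finset.sum_image (fun a _ b _ hab => hy hab)
  have hx : y k ∈ s := Finset.mem_insert_self _ _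
  have hl : l ∈ I := Finset.mem_filter.2 ⟨Finset.mem_erase.2 ⟨hkl.symm, Finset.mem_univ _⟩, hlt.le.trans hρR⟩
  have hq : y l ∈ s := Finset.mem_insert_of_mem (Finset.mem_image_of_mem y hl)
  have hqx : y l ≠ y k := fun hh => hkl (hy hh).symm
  have hR0 : 0 ≤ R := by linarith
  have hpre : ∀ z ∈ s, ∃ m : Fin N, y m = z := by
    intro z hz
    rcases Finset.mem_insert.1 hz with rfl | hz
    · exact ⟨k, rfl⟩
    · obtain ⟨m, -, rfl⟩ := Finset.mem_image.1 hz
      exact ⟨m, rfl⟩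
  have hwithin : ∀ z ∈ s, dist (y k) z ≤ R := by
    intro z hz
    rcases Finset.mem_insert.1 hz with rfl | hz
    · rw [dist_self]; exact hR0
    · obtain ⟨m, hm, rfl⟩ := Finset.mem_image.1 hz
      exact (Finset.mem_filter.1 hm).2
  have hssep : ∀ z ∈ s, ∀ w ∈ s, z ≠ w → (7 : ℝ) / 10 ≤ dist z w := by
    intro z hz w hw hzw
    obtain ⟨m, rfl⟩ := hpre z hz
    obtain ⟨m', rfl⟩ := hpre w hw
    exact hsep m m' (fun hh => hzw (congrArg y hh))
  have hforce : ∀ e : E3, |∑ z ∈ s.erase (y k), forceTerm (y k) z e| ≤ tailF R * ‖e‖ := by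
    intro e
    rw [hserase, hsum_image (fun z => forceTerm (y k) z e)]
    have h0 := (forceBalancedAt_iff y k).1 hF e
    rw [sum_erase_eq_near_add_far R y k] at h0
    have hnear : ∑ m ∈ nearIdx R y k, forceTerm (y k) (y m) e = -∑ m ∈ farIdx R y k, forceTerm (y k) (y m) e := by linarith
    rw [← hI] at hnear
    rw [hnear, abs_neg]
    exact abs_sum_far_forceTerm_le hy hsep k hR e
  have hβ := h s (y k) (y l) hx hq hqx hwithin hssep hlt hforce
  rw [hserase, hsum_image (fun z => lennardJones (dist (y k) z))] at hβ
  have hfar := sum_far_abs_lennardJones_le hy hsep k hR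
  have hfar' : -tailE R ≤ ∑ m ∈ farIdx R y k, lennardJones (dist (y k) (y m)) := by
    have h1 := Finset.abs_sum_le_sum_abs (fun m => lennardJones (dist (y k) (y m))) (farIdx R y k)
    have h2 := neg_abs_le (∑ m ∈ farIdx R y k, lennardJones (dist (y k) (y m)))
    linarith
  show b ≤ siteEnergy lennardJones y k
  unfold siteEnergy
  rw [sum_erase_eq_near_add_far R y k, ← hI]
  linarith

/-- **`FinContactHotAbove ρ R`** — the finite-range law at range `R` at SOME floor beating `e⋆` by more than the energy tail. -/
def FinContactHotAbove (ρ R : ℝ) : Prop := ∃ β : ℝ, eStar + tailE R < β ∧ FinContactHot ρ β R (tailF R)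

/-- **HOT ⟸ its finite-range form (PROVED):** `FinContactHotAbove ρ R ⟹ ContactHotAbove ρ` for `1 ≤ R`, `ρ ≤ R`. -/
theorem contactHotAbove_of_fin {ρ R : ℝ} (hR : 1 ≤ R) (hρR : ρ ≤ R) (h : FinContactHotAbove ρ R) : ContactHotAbove ρ := by
  obtain ⟨β, hβ, h⟩ := h
  have h' : FinContactHot ρ ((β - tailE R) + tailE R) R (tailF R) := by rw [sub_add_cancel]; exact h
  exact ⟨β - tailE R, by linarith, contactHot_of_finContactHot hR hρR h'⟩

/-! ### Reach: `R = 8` with the dyadic tail, any certified tails, `R = 5` with the integer-shell tail -/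

/-- **STUB 3 ⟸ the finite law at range `8` with floor `−0.30` (PROVED modulo the landed `e⋆ ≤ −0.711`):**
`FinContactHot (3/4) (−3/10) 8 (tailF 8) ⟹ ContactHotAbove (3/4)` — every `7/10`-separated set of at most `(167/7)³ < 13 600` points in one
closed `8`-ball about a point `x` with a contact closer than `3/4` and net force on `x` of norm `≤ tailF 8 < 0.31` gives `x` an energy `≥ −0.30`. -/
theorem contactHotAbove_threeQuarters_of_fin8 (he : eStar ≤ -(711 / 1000)) (h : FinContactHot (3 / 4) (-(3 / 10)) 8 (tailF 8)) :
    ContactHotAbove (3 / 4) := by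
  refine contactHotAbove_of_fin (by norm_num) (by norm_num) ⟨-(3 / 10), ?_, h⟩
  have := tailE_eight
  linarith

/-- The same at a general range: a finite floor `β` at range `R ≥ 1` with `β − tailE R > −0.711` gives stub 3. -/
theorem contactHotAbove_threeQuarters_of_fin {R β : ℝ} (hR : 1 ≤ R) (he : eStar ≤ -(711 / 1000))
    (hβ : -(711 / 1000) + tailE R < β) (h : FinContactHot (3 / 4) β R (tailF R)) : ContactHotAbove (3 / 4) :=
  contactHotAbove_of_fin hR (by linarith) ⟨β, by linarith, h⟩

/-- **THE GENERAL BRIDGE (PROVED):** for any certified tails `FarTails R E F` (`0 ≤ R`, `ρ ≤ R`), `FinContactHot ρ (b + E) R F ⟹ ContactHot ρ b`. -/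
theorem contactHot_of_finContactHot_of_farTails {ρ b R E F : ℝ} (hR0 : 0 ≤ R) (hρR : ρ ≤ R) (hT : FarTails R E F)
    (h : FinContactHot ρ (b + E) R F) : ContactHot ρ b := by
  intro N y hy hsep k l hkl hlt hF
  obtain ⟨hx, hserase, hwithin, hssep, -⟩ := truncation_facts hy hsep k hR0
  set s : Finset E3 := insert (y k) ((nearIdx R y k).image y) with hs
  have hsum_image : ∀ (t : Finset (Fin N)) (g : E3 → ℝ), ∑ z ∈ t.image y, g z = ∑ m ∈ t, g (y m) :=
    fun t g => Finset.sum_image (fun a _ b _ hab => hy hab)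
  have hl : l ∈ nearIdx R y k := Finset.mem_filter.2 ⟨Finset.mem_erase.2 ⟨hkl.symm, Finset.mem_univ _⟩, hlt.le.trans hρR⟩
  have hq : y l ∈ s := Finset.mem_insert_of_mem (Finset.mem_image_of_mem y hl)
  have hqx : y l ≠ y k := fun hh => hkl (hy hh).symm
  have hTk := hT N y hy hsep k
  have hforce : ∀ e : E3, |∑ z ∈ s.erase (y k), forceTerm (y k) z e| ≤ F * ‖e‖ := by
    intro e
    rw [hserase, hsum_image _ (fun z => forceTerm (y k) z e)]
    have h0 := (forceBalancedAt_iff y k).1 hF e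
    rw [sum_erase_eq_near_add_far R y k] at h0
    have hnear : ∑ m ∈ nearIdx R y k, forceTerm (y k) (y m) e = -∑ m ∈ farIdx R y k, forceTerm (y k) (y m) e := by linarith
    rw [hnear, abs_neg]
    exact hTk.2 e
  have hβ := h s (y k) (y l) hx hq hqx hwithin hssep hlt hforce
  rw [hserase, hsum_image _ (fun z => lennardJones (dist (y k) z))] at hβ
  have hfar := hTk.1
  have hfar' : -E ≤ ∑ m ∈ farIdx R y k, lennardJones (dist (y k) (y m)) := by
    have h1 := Finset.abs_sum_le_sum_abs (fun m => lennardJones (dist (y k) (y m))) (farIdx R y k)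
    have h2 := neg_abs_le (∑ m ∈ farIdx R y k, lennardJones (dist (y k) (y m)))
    linarith
  show b ≤ siteEnergy lennardJones y k
  unfold siteEnergy
  rw [sum_erase_eq_near_add_far R y k]
  linarith

/-- **STUB 3 ⟸ THE CALIBRATED FINITE INSTRUMENT AT RANGE 5 (PROVED mod `e⋆ ≤ −0.711`):** `FinContactHot (3/4) (−1/2) 5 ((5⁻¹ + 5⁻⁷)·τ₅)`
— `7/10`-separated point sets in ONE closed `5`-ball (at most `(100/7+1)³ < 3 600` points), force residual `< 0.24`, floor `−1/2` on the
truncated energy — implies HOT at `3/4` (`τ₅/6 < 0.2 < 0.711 − 0.5`). -/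
theorem contactHotAbove_threeQuarters_of_fin5 (he : eStar ≤ -(711 / 1000))
    (h : FinContactHot (3 / 4) (-(1 / 2)) 5 ((((5 : ℕ) : ℝ)⁻¹ + (((5 : ℕ) : ℝ))⁻¹ ^ 7) * tauShell 5)) : ContactHotAbove (3 / 4) := by
  have hT := farTails_shells (n := 5) (by norm_num)
  have h5 := tauShell_five_lt
  refine ⟨-(1 / 2) - 1 / 6 * tauShell 5, by linarith, ?_⟩
  exact contactHot_of_finContactHot_of_farTails (by norm_num) (by norm_num) hT (by
    have e : -(1 / 2) - 1 / 6 * tauShell 5 + 1 / 6 * tauShell 5 = -(1 / 2) := by ring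
    rw [e]; exact h)

/-! ### THIN¾ — the residual on `3/4`-separated ground states (EQUIVALENT to THIN modulo HOT, PROVED) -/

/-- `SepAll ρ y` — the configuration is `ρ`-separated. -/
def SepAll (ρ : ℝ) {N : ℕ} (y : Fin N → E3) : Prop := ∀ k l : Fin N, k ≠ l → ρ ≤ dist (y k) (y l)

/-- **THIN¾ · `ThinSepSurgeryCertificate s N₀ s₀ g`** — THIN's certificate restricted to `3/4`-SEPARATED ground states. -/
def ThinSepSurgeryCertificate (s : ℝ) (N₀ : ℕ) (s₀ g : ℝ) : Prop :=
  ∀ N : ℕ, N₀ ≤ N → ∀ y : Fin N → E3, IsGroundState lennardJones y → SepAll (3 / 4) y → ShallowFar s y →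
    (∃ i : Fin N, i ∈ farSet 2 (3 / 50) 6 y) → ∃ c : Fin N, Improvable eStar g s₀ y c

/-- **THIN¾ · `ThinSepCertified s`** [DECLARED RESIDUAL of generation 19 · WEAKER than THIN (restriction) · EQUIVALENT to THIN modulo HOT ·
its world: large, `3/4`-separated ground states whose far matter is non-empty and `s`-shallow; BARRIER-core through TENUOUS; the range dial
does not reach it (global hypothesis)]. -/
def ThinSepCertified (s : ℝ) : Prop :=
  ∃ N₀ : ℕ, ∃ s₀ g : ℝ, 0 ≤ s₀ ∧ 0 < g ∧ ThinSepSurgeryCertificate s N₀ s₀ g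

/-- THIN¾ is WEAKER than THIN (restriction). -/
theorem thinSepCertified_of_thinCertified {s : ℝ} (h : ThinCertified s) : ThinSepCertified s := by
  obtain ⟨N₀, s₀, g, hs₀, hg, h⟩ := h
  exact ⟨N₀, s₀, g, hs₀, hg, fun N hN y hy _ hsh hfar => h N hN y hy hsh hfar⟩

/-- **THIN ⟸ THIN¾ ∧ (GS contact law at `3/4` above `e⋆`) (PROVED):** a ground state with a pair closer than `3/4` is certified by DELETING
the hot particle (`improvable_of_warmSite`); a `3/4`-separated one is THIN¾'s. -/
theorem thinCertified_of_sep_contactHotGS {s b : ℝ} (hb : eStar < b) (hH : ContactHotGS (3 / 4) b) (hT : ThinSepCertified s) :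
    ThinCertified s := by
  obtain ⟨N₀, s₀, g, hs₀, hg, hT⟩ := hT
  refine ⟨N₀, max s₀ 1, min g (b - eStar), le_max_of_le_left hs₀, lt_min hg (sub_pos.2 hb), fun N hN y hy hsh hfar => ?_⟩
  by_cases hsep : SepAll (3 / 4) y
  · obtain ⟨c, hc⟩ := hT N hN y hy hsep hsh hfar
    exact ⟨c, improvable_weaken (min_le_left _ _) (le_max_left _ _) hs₀ hc⟩
  · unfold SepAll at hsep
    push Not at hsep
    obtain ⟨k, l, hkl, hd⟩ := hsep
    have hsite := hH N y hy k l hkl hd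
    have hk : Improvable eStar (b - eStar) 1 y k :=
      improvable_of_warmSite hy.1 one_pos (by rw [dist_self]; norm_num) (by linarith)
    exact ⟨k, improvable_weaken (min_le_right _ _) (le_max_right _ _) zero_le_one hk⟩

/-- **THIN ⟸ THIN¾ ∧ HOT (PROVED).** -/
theorem thinCertified_of_sep_hot {s : ℝ} (hH : ContactHotAbove (3 / 4)) (hT : ThinSepCertified s) : ThinCertified s := by
  obtain ⟨b, hb, hH⟩ := hH
  exact thinCertified_of_sep_contactHotGS hb (contactHotGS_of_contactHot hH) hT

/-- **Modulo HOT the residual is EXACTLY THIN¾ (PROVED).** -/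
theorem thinCertified_iff_sep_of_hot {s : ℝ} (hH : ContactHotAbove (3 / 4)) : ThinCertified s ↔ ThinSepCertified s :=
  ⟨thinSepCertified_of_thinCertified, thinCertified_of_sep_hot hH⟩

/-- Past the second threshold `MinSepGS (3/4)` the two coincide outright. -/
theorem thinCertified_of_sep_minSep {s : ℝ} (hM : MinSepGS (3 / 4)) (hT : ThinSepCertified s) : ThinCertified s := by
  obtain ⟨N₀, s₀, g, hs₀, hg, hT⟩ := hT
  exact ⟨N₀, s₀, g, hs₀, hg, fun N hN y hy hsh hfar => hT N hN y hy (fun k l hkl => hM N y hy k l hkl) hsh hfar⟩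

end Summit.AtomisticToContinuum.Crystallization.Theorems.LoopTunnelDialFinContact
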